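import Mathlib
import Literature.Computability.AlgebraicComplexity.PrattTrapezoidValSDPP

/-!
# Large corner-free subsets of `ℤ_D × ℤ_D` — stub `stub_cornerFreeSquares` of line `registered`
(crux `EisensteinValCertificates.HomocyclicSTPPDesigns`, stmt-MatrixMultiplication-10647)

Behrend-type existence of large corner-free "squares": for every `η > 0` and all large `D` there
is `S ⊆ ℤ_D × ℤ_D` with `|S| ≥ D^{2-η}` containing no planar corner
`{(x, y), (x + δ, y), (x + δ, y - δ)}` with `δ ≠ 0`. In the clustered-charts reshape of the line,
the rows of a CKSU chart are indexed by (class word) × (value pair in `S`), and a triple of rows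
violates the USP condition exactly along such a corner; the count stub consumes this statement at
the moduli `D = d^t`.

Proof: with `η' := min η 1 / 2` take `m₀` from the tree lemma `exists_threeAPFree_card_ge_rpow`
(`m^{1-η'} ≤ rothNumberNat m` for `m ≥ m₀`, from Mathlib's `Behrend.roth_lower_bound`). For `D`
large put `N := D / 2`, pick a 3AP-free `T ⊆ {0, …, N-1}` with `|T| = rothNumberNat N`
(`rothNumberNat_spec`), and let `S := {(x, t - 2x) : x < D, t ∈ T}` (casts into `ZMod D`), i.e.
`S = {(x, y) : 2x + y ∈ T}`. A corner in `S` gives `t₀ = 2x + y`, `t₁ = 2x + y + 2δ`,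
`t₂ = 2x + y + δ` in `T` (mod `D`) with `t₀ + t₁ ≡ t₂ + t₂`; as `t₀ + t₁, 2 t₂ < 2N ≤ D` this is
an equality of naturals, so `t₀ = t₂` by 3AP-freeness and `δ = t₂ - t₀ = 0`. The parametrisation
is injective on `[0, D) × T`, so `|S| = D |T| ≥ D · N^{1-η'} ≥ D^{2-η'} / 3 ≥ D^{2-2η'} ≥ D^{2-η}`
once `3 ≤ D^{η'}`.

Sources: F. A. Behrend, *On sets of integers which contain no three terms in arithmetical
progression*, PNAS 32 (1946) (via Mathlib `Behrend.roth_lower_bound`); M. Ajtai, E. Szemerédi,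
*Sets of lattice points that form no squares*, Studia Sci. Math. Hungar. 9 (1974) (the lift
`(x, y) ↦ 2x + y` from 3AP-free sets to corner-free sets); H. Cohn, R. Kleinberg, B. Szegedy,
C. Umans, *Group-theoretic algorithms for matrix multiplication*, FOCS 2005, §6.2. Not here: the
chart pattern, the rows design and the rows count (neighbouring stubs of the same line).
-/

set_option linter.dupNamespace false
-- (single-conjunct summit: the namespace repeats `MatrixMultiplication`)

namespace Summit.MatrixMultiplication.MatrixMultiplication.Theorems.HomocyclicSTPPDesigns.ClusteredCharts

open Finset Literature.Computability.AlgebraicComplexity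

/-- **Corner-free squares** (registered stub `stub_cornerFreeSquares` of line `registered`; known,
Behrend): for every `η > 0` there is `D₀` such that for all `D ≥ D₀` some `S ⊆ ℤ_D × ℤ_D` with
`D^{2-η} ≤ |S|` contains no pattern `{(x, y), (x + δ, y), (x + δ, y - δ)}` with `δ ≠ 0`.
The set is `S = {(x, t - 2x) : x ∈ ℤ_D, t ∈ T}` for a 3AP-free `T ⊆ [0, D/2)` of size
`rothNumberNat (D/2)` (tree `exists_threeAPFree_card_ge_rpow`): the three points of a corner have
`2x + y`-values `t, t + 2δ, t + δ`, a 3-term progression of residues represented in `[0, D/2)`,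
hence a genuine 3-term progression in `T`. -/
theorem stub_cornerFreeSquares :
    ∀ η : ℝ, 0 < η → ∃ D₀ : ℕ, ∀ D ≥ D₀, ∃ S : Finset (ZMod D × ZMod D),
      (∀ x y δ : ZMod D, (x, y) ∈ S → (x + δ, y) ∈ S → (x + δ, y - δ) ∈ S → δ = 0) ∧
      (D : ℝ) ^ (2 - η) ≤ S.card := by
  intro η hη
  -- the Behrend exponent `η'`, with `0 < η' ≤ 1 / 2` and `2 η' ≤ η`
  obtain ⟨η', hη', hη'1, hη'η⟩ : ∃ η' : ℝ, 0 < η' ∧ η' ≤ 1 / 2 ∧ 2 * η' ≤ η := by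
    have h0 : 0 < min η 1 := lt_min hη one_pos
    have h1 : min η 1 ≤ 1 := min_le_right η 1
    have h2 : min η 1 ≤ η := min_le_left η 1
    exact ⟨min η 1 / 2, by linarith, by linarith, by linarith⟩
  -- Behrend: large 3AP-free sets of naturals
  obtain ⟨m₀, hm₀⟩ := exists_threeAPFree_card_ge_rpow η' hη'
  -- the threshold beyond which `3 ≤ D ^ η'`
  obtain ⟨D₁, hD₁⟩ : ∃ D₁ : ℕ, ∀ D ≥ D₁, (3 : ℝ) ≤ (D : ℝ) ^ η' := by
    have h := ((tendsto_rpow_atTop hη').comp tendsto_natCast_atTop_atTop).eventually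
      (Filter.eventually_ge_atTop (3 : ℝ))
    obtain ⟨D₁, hD₁⟩ := Filter.eventually_atTop.1 h
    exact ⟨D₁, hD₁⟩
  refine ⟨2 * m₀ + D₁ + 3, fun D hD => ?_⟩
  classical
  -- a 3AP-free `T ⊆ range N`, `N = D / 2`, of size `rothNumberNat N ≥ N ^ (1 - η')`
  obtain ⟨N, hN⟩ : ∃ N : ℕ, N = D / 2 := ⟨_, rfl⟩
  have hND : 2 * N ≤ D := by omega
  have hDN : D ≤ 3 * N := by omega
  have hNm₀ : m₀ ≤ N := by omega
  obtain ⟨T, hTsub, hTcard, hT3⟩ := rothNumberNat_spec N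
  have hTlt : ∀ t ∈ T, t < N := fun t ht => mem_range.1 (hTsub ht)
  -- casts `ℕ → ZMod D` are injective below `D`
  have hcast : ∀ a b : ℕ, a < D → b < D → (a : ZMod D) = (b : ZMod D) → a = b := by
    intro a b ha hb hab
    have h := (ZMod.natCast_eq_natCast_iff' a b D).1 hab
    rwa [Nat.mod_eq_of_lt ha, Nat.mod_eq_of_lt hb] at h
  -- the parametrisation `(x, t) ↦ (x, t - 2x)` of `S = {(x, y) : 2x + y ∈ T}`
  set f : ℕ × ℕ → ZMod D × ZMod D :=
    fun p => ((p.1 : ZMod D), (p.2 : ZMod D) - 2 * (p.1 : ZMod D)) with hf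
  have hinj : Set.InjOn f ↑(range D ×ˢ T) := by
    rintro ⟨a, t⟩ hp ⟨a', t'⟩ hq hpq
    simp only [mem_coe, mem_product, mem_range] at hp hq
    simp only [hf, Prod.mk.injEq] at hpq
    obtain ⟨h1, h2⟩ := hpq
    have ha : a = a' := hcast a a' hp.1 hq.1 h1
    subst ha
    have ht : (t : ZMod D) = (t' : ZMod D) := by linear_combination h2
    have hlt : t < D := by have := hTlt t hp.2; omega
    have hlt' : t' < D := by have := hTlt t' hq.2; omega
    rw [hcast t t' hlt hlt' ht]
  refine ⟨(range D ×ˢ T).image f, ?_, ?_⟩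
  · -- corner-freeness
    intro x y δ h₀ h₁ h₂
    simp only [mem_image, mem_product, mem_range, Prod.exists, hf, Prod.mk.injEq] at h₀ h₁ h₂
    obtain ⟨a₀, t₀, ⟨-, ht₀⟩, ha₀, hy₀⟩ := h₀
    obtain ⟨a₁, t₁, ⟨-, ht₁⟩, ha₁, hy₁⟩ := h₁
    obtain ⟨a₂, t₂, ⟨-, ht₂⟩, ha₂, hy₂⟩ := h₂
    rw [ha₀] at hy₀
    rw [ha₁] at hy₁
    rw [ha₂] at hy₂
    -- `t₀ + t₁ = t₂ + t₂` in `ZMod D`, hence in `ℕ`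
    have hmod : ((t₀ + t₁ : ℕ) : ZMod D) = ((t₂ + t₂ : ℕ) : ZMod D) := by
      push_cast
      linear_combination hy₀ + hy₁ - 2 * hy₂
    have hlt₀₁ : t₀ + t₁ < D := by
      have := hTlt t₀ ht₀
      have := hTlt t₁ ht₁
      omega
    have hlt₂ : t₂ + t₂ < D := by
      have := hTlt t₂ ht₂
      omega
    have hnat : t₀ + t₁ = t₂ + t₂ := hcast _ _ hlt₀₁ hlt₂ hmod
    have h02 : t₀ = t₂ := hT3 ht₀ ht₂ ht₁ hnat
    subst h02
    linear_combination hy₀ - hy₂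
  · -- size: `|S| = D |T| ≥ D N^{1-η'} ≥ D^{2-η'} / 3 ≥ D^{2-2η'} ≥ D^{2-η}`
    have hcardS : #((range D ×ˢ T).image f) = D * #T := by
      rw [card_image_of_injOn hinj, card_product, card_range]
    rw [hcardS]
    push_cast
    have hDpos : (0 : ℝ) < D := by exact_mod_cast (show 0 < D by omega)
    have hD1 : (1 : ℝ) ≤ D := by exact_mod_cast (show 1 ≤ D by omega)
    have hT : (N : ℝ) ^ (1 - η') ≤ #T := by rw [hTcard]; exact hm₀ N hNm₀
    have h3 : (3 : ℝ) ≤ (D : ℝ) ^ η' := hD₁ D (by omega)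
    have hDN3 : (D : ℝ) / 3 ≤ N := by
      rw [div_le_iff₀ (by norm_num : (0 : ℝ) < 3)]
      exact_mod_cast (show D ≤ N * 3 by omega)
    have h1η' : 0 ≤ 1 - η' := by linarith
    -- `D ^ (1 - η') ≤ 3 * N ^ (1 - η')`
    have hpow : (D : ℝ) ^ (1 - η') ≤ 3 * (N : ℝ) ^ (1 - η') := by
      have h31 : (3 : ℝ) ^ (1 - η') ≤ 3 := by
        calc (3 : ℝ) ^ (1 - η') ≤ (3 : ℝ) ^ (1 : ℝ) :=
              Real.rpow_le_rpow_of_exponent_le (by norm_num) (by linarith)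
          _ = 3 := Real.rpow_one 3
      calc (D : ℝ) ^ (1 - η') = (3 * ((D : ℝ) / 3)) ^ (1 - η') := by
            rw [mul_div_cancel₀ _ (by norm_num : (3 : ℝ) ≠ 0)]
        _ = (3 : ℝ) ^ (1 - η') * ((D : ℝ) / 3) ^ (1 - η') :=
            Real.mul_rpow (by norm_num) (by positivity)
        _ ≤ 3 * (N : ℝ) ^ (1 - η') :=
            mul_le_mul h31 (Real.rpow_le_rpow (by positivity) hDN3 h1η')
              (Real.rpow_nonneg (by positivity) _) (by norm_num)
    -- assemble
    have hmain : 3 * (D : ℝ) ^ (2 - 2 * η') ≤ 3 * ((D : ℝ) * #T) :=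
      calc 3 * (D : ℝ) ^ (2 - 2 * η') ≤ (D : ℝ) ^ η' * (D : ℝ) ^ (2 - 2 * η') :=
            mul_le_mul_of_nonneg_right h3 (Real.rpow_nonneg hDpos.le _)
        _ = (D : ℝ) * (D : ℝ) ^ (1 - η') := by
            rw [← Real.rpow_add hDpos, show η' + (2 - 2 * η') = 1 + (1 - η') by ring,
              Real.rpow_add hDpos, Real.rpow_one]
        _ ≤ (D : ℝ) * (3 * (N : ℝ) ^ (1 - η')) := mul_le_mul_of_nonneg_left hpow hDpos.le
        _ = 3 * ((D : ℝ) * (N : ℝ) ^ (1 - η')) := by ring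
        _ ≤ 3 * ((D : ℝ) * #T) := by gcongr
    calc (D : ℝ) ^ (2 - η) ≤ (D : ℝ) ^ (2 - 2 * η') :=
          Real.rpow_le_rpow_of_exponent_le hD1 (by linarith)
      _ ≤ (D : ℝ) * #T := le_of_mul_le_mul_left hmain (by norm_num)

end Summit.MatrixMultiplication.MatrixMultiplication.Theorems.HomocyclicSTPPDesigns.ClusteredCharts
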